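import Summits.BirchSwinnertonDyer.BirchSwinnertonDyer.Theses.AdditiveKolyvaginRoad
import HarnessLib

/-!
# Route `AdditiveKolyvaginRoad`: the assembly item `Assembly` (stmt-BirchSwinnertonDyer-20139), PROVED

`Assembly` = the type of the route's deciding theorem `closes` (planner bsd-wall-add g0, kernel-checked in the route
file): the cruxes `KolyvaginPrimitiveAdditive`, `RankZeroAdditive`, `OffSharpRankOneAdditive`, `AdditiveAtThree`,
`ManinGoodOddFrameAdditive`, the published inputs and the additive Kolyvagin kernel give the registered W-ALL leaf
`Summit.BirchSwinnertonDyer.WAllExclAdditive`. Proof (rev 5–9): `closes` itself. No named fact, no `sorry`.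
(cell `pub/bsd-wall`, lead prover `bsd-wall-akr-p1` g2; `--workitem stmt-BirchSwinnertonDyer-20139`.)
[cite: WZhang2014, Thm. 1.1] [cite: Miller2011LMS, Thm. 1.1]

Proof-only re-land (route rev 11, `bsd-wall-akr-p2` g5, NOTE G26-N5): since rev 10 the deciding theorem `closes`
binds the SPLIT Manin pieces (`EdixhovenManinNonPotOrdinary`, …, `ManinFrameResidueProper`, 17 hypotheses) and
derives `ManinGoodOddFrameAdditive` inline, while `Assembly` keeps its 7-hypothesis statement with the frame crux
`ManinGoodOddFrameAdditive` as ONE binder. The statement below is unchanged; its proof is now the dispatch tail of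
`closes` (p = 3 → `AdditiveAtThree`; r_an = 0 → `RankZeroAdditive`; r_an = 1 on the ♯-locus → the kernel
`AdditiveKolyvaginKernel` fed with the frame hypothesis directly; r_an = 1 off ♯ → `OffSharpRankOneAdditive`),
so the file no longer depends on the arity of `closes`.
-/

-- single-conjunct summit: `Summit.BirchSwinnertonDyer.BirchSwinnertonDyer.…` repeats the name by design
set_option linter.dupNamespace false

namespace Summit.BirchSwinnertonDyer.BirchSwinnertonDyer.Theorems.AdditiveKoly

open Summit.BirchSwinnertonDyer.BirchSwinnertonDyer.Theses.AdditiveKolyvaginRoad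

/-- **The assembly item 20139**: the cruxes `KolyvaginPrimitiveAdditive`, `RankZeroAdditive`,
`OffSharpRankOneAdditive`, `AdditiveAtThree`, the Manin-good odd frame `ManinGoodOddFrameAdditive`, the
published inputs and the additive Kolyvagin kernel give the W-ALL leaf `WAllExclAdditive`. Proof = the
dispatch tail of the route's deciding theorem `closes` with the frame hypothesis `hM` supplied directly
(p = 3 · analytic rank 0 · rank 1 on the ♯-locus via the kernel · rank 1 off ♯). [cite: WZhang2014, Thm. 1.1] -/
theorem assembly : Assembly := by
  intro h₁ h₀ hoff h₃ hM hP hK W _ _ p _ hCM hp2 hadd hr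
  have hp : p.Prime := Fact.out
  by_cases hp3 : p = 3
  · subst hp3
    exact h₃ W hCM hadd hr
  · have hp5 : 5 ≤ p := hp.five_le_of_ne_two_of_ne_three hp2 hp3
    rcases Nat.lt_or_ge W.analyticRank 1 with hr0 | hr1
    · exact h₀ W p hCM hp5 hadd (by omega)
    · have hr1' : W.analyticRank = 1 := le_antisymm hr hr1
      by_cases hsharp : (W.HasSurjectiveModNGaloisRep p ∧
          (∀ (ℓ : ℕ) [Fact ℓ.Prime], W.HasMultiplicativeReductionAtPrime ℓ →
            ¬ p ∣ padicValInt ℓ W.minimalDiscriminantInt) ∧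
          (∃ (ℓ₁ ℓ₂ : ℕ) (_ : Fact ℓ₁.Prime) (_ : Fact ℓ₂.Prime), ℓ₁ ≠ ℓ₂ ∧
            W.HasMultiplicativeReductionAtPrime ℓ₁ ∧ W.HasMultiplicativeReductionAtPrime ℓ₂) ∧
          ¬ p ∣ W.tamagawaProduct)
      · obtain ⟨hs, hsp, htwo, htam⟩ := hsharp
        exact hK hP hM h₁ h₀ W p hCM hp5 hadd hr1' hs hsp htwo htam
      · exact hoff W p hCM hp5 hadd hr1' hsharp

end Summit.BirchSwinnertonDyer.BirchSwinnertonDyer.Theorems.AdditiveKoly
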